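import Mathlib

/-!
# Strong-coupling floor engine, part 17: elementary lattice sums on the spatial torus `(ℤ/(2S+1))³`

Pooled prover `ym-ir-line-bsf-p1` (crux `IR`, stmt-QuantumFields-19354), support for the consumer rung R2 of line
`momentum-pincer` (`NoLightMoversSCTransfer`): the slice sums `Σ_{x⃗ ∈ (ℤ/(2S+1))³}` of geometrically decaying
weights are bounded UNIFORMLY IN `S`.  With `x̃ = valMinAbs x ∈ ℤ` the centred representative:
* `sum_half_pow_natAbs_le` — `Σ_{v ∈ T} (1/2)^{|v|} ≤ 4` for every finite `T ⊆ ℤ`;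
* `sum_zmod_half_pow_le` — `Σ_{k ∈ ℤ/n} (1/2)^{|k̃|} ≤ 4`;
* `sum_spatial_weight_le` — `Σ_{x⃗} ∏ᵢ (1/2)^{|x̃ᵢ|} ≤ 64`;
* `eighth_pow_sub_le_weight` — `(1/8)^{m − n₀} ≤ 8^{n₀} ∏ᵢ (1/2)^{|ṽᵢ|}` whenever `|ṽᵢ| ≤ m` for all `i` (the
  sup-norm decay of a far term dominates the product weight).
Elementary; nothing here bears on the Yang–Mills mass gap.
-/

set_option autoImplicit false

open Finset

namespace Summit.QuantumFields.YangMills.Cruxes.IR.SCFloor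

/-- `Σ_{v ∈ T} (1/2)^{|v|} ≤ 4` for every finite set of integers `T`. -/
theorem sum_half_pow_natAbs_le (T : Finset ℤ) : ∑ v ∈ T, ((1 : ℝ) / 2) ^ v.natAbs ≤ 4 := by
  classical
  have hgeo : ∀ A : Finset ℕ, ∑ n ∈ A, ((1 : ℝ) / 2) ^ n ≤ 2 := fun A =>
    (summable_geometric_two.sum_le_tsum A (fun n _ => by positivity)).trans tsum_geometric_two.le
  have hsplit : ∑ v ∈ T, ((1 : ℝ) / 2) ^ v.natAbs =
      ∑ v ∈ T.filter (fun v => 0 ≤ v), ((1 : ℝ) / 2) ^ v.natAbs +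
        ∑ v ∈ T.filter (fun v => ¬ 0 ≤ v), ((1 : ℝ) / 2) ^ v.natAbs :=
    (Finset.sum_filter_add_sum_filter_not T (fun v => 0 ≤ v) _).symm
  have hpos : ∑ v ∈ T.filter (fun v => 0 ≤ v), ((1 : ℝ) / 2) ^ v.natAbs ≤ 2 := by
    have hinj : Set.InjOn Int.natAbs (T.filter (fun v => 0 ≤ v) : Set ℤ) := by
      intro a ha b hb hab
      simp only [Finset.coe_filter, Set.mem_setOf_eq] at ha hb
      exact Int.natAbs_inj_of_nonneg_of_nonneg ha.2 hb.2 |>.1 hab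
    rw [← Finset.sum_image (f := fun n : ℕ => ((1 : ℝ) / 2) ^ n) hinj]
    exact hgeo _
  have hneg : ∑ v ∈ T.filter (fun v => ¬ 0 ≤ v), ((1 : ℝ) / 2) ^ v.natAbs ≤ 2 := by
    have hinj : Set.InjOn Int.natAbs (T.filter (fun v => ¬ 0 ≤ v) : Set ℤ) := by
      intro a ha b hb hab
      simp only [Finset.coe_filter, Set.mem_setOf_eq, not_le] at ha hb
      exact Int.natAbs_inj_of_nonpos_of_nonpos ha.2.le hb.2.le |>.1 hab
    rw [← Finset.sum_image (f := fun n : ℕ => ((1 : ℝ) / 2) ^ n) hinj]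
    exact hgeo _
  rw [hsplit]; linarith

/-- `Σ_{k ∈ ℤ/n} (1/2)^{|k̃|} ≤ 4`, `k̃ = valMinAbs k`. -/
theorem sum_zmod_half_pow_le (n : ℕ) [NeZero n] :
    ∑ k : ZMod n, ((1 : ℝ) / 2) ^ k.valMinAbs.natAbs ≤ 4 := by
  classical
  have hinj : Set.InjOn (ZMod.valMinAbs : ZMod n → ℤ) (Finset.univ : Finset (ZMod n)) :=
    fun a _ b _ hab => by simpa using congrArg (fun z : ℤ => (z : ZMod n)) hab
  rw [← Finset.sum_image (f := fun v : ℤ => ((1 : ℝ) / 2) ^ v.natAbs) hinj]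
  exact sum_half_pow_natAbs_le _

/-- `Σ_{x⃗ ∈ (ℤ/n)³} ∏ᵢ (1/2)^{|x̃ᵢ|} ≤ 64`. -/
theorem sum_spatial_weight_le (n : ℕ) [NeZero n] :
    ∑ x : Fin 3 → ZMod n, ∏ i : Fin 3, ((1 : ℝ) / 2) ^ (x i).valMinAbs.natAbs ≤ 64 := by
  classical
  have h := (Finset.prod_univ_sum (fun (_ : Fin 3) => (Finset.univ : Finset (ZMod n)))
    (fun _ k => ((1 : ℝ) / 2) ^ k.valMinAbs.natAbs)).symm
  rw [Fintype.piFinset_univ] at h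
  rw [h, Finset.prod_const, Finset.card_univ, Fintype.card_fin]
  have h4 := sum_zmod_half_pow_le n
  have h0 : 0 ≤ ∑ k : ZMod n, ((1 : ℝ) / 2) ^ k.valMinAbs.natAbs := Finset.sum_nonneg fun _ _ => by positivity
  nlinarith [mul_le_mul h4 h4 h0 (by norm_num : (0:ℝ) ≤ 4), mul_nonneg h0 h0]

/-- **Sup-norm decay dominates the product weight**: if `|ṽᵢ| ≤ m` for `i < 3`, then
`(1/8)^{m − n₀} ≤ 8^{n₀} ∏ᵢ (1/2)^{|ṽᵢ|}` (truncated subtraction). -/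
theorem eighth_pow_sub_le_weight (v : Fin 3 → ℤ) (m n₀ : ℕ) (hv : ∀ i, (v i).natAbs ≤ m) :
    ((1 : ℝ) / 8) ^ (m - n₀) ≤ (8 : ℝ) ^ n₀ * ∏ i : Fin 3, ((1 : ℝ) / 2) ^ (v i).natAbs := by
  -- `∏ᵢ (1/2)^{|ṽᵢ|} ≥ (1/2)^{3m} = (1/8)^m`
  have hprod : ((1 : ℝ) / 8) ^ m ≤ ∏ i : Fin 3, ((1 : ℝ) / 2) ^ (v i).natAbs := by
    have h1 : ∀ i : Fin 3, ((1 : ℝ) / 2) ^ m ≤ ((1 : ℝ) / 2) ^ (v i).natAbs := fun i =>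
      pow_le_pow_of_le_one (by norm_num) (by norm_num) (hv i)
    calc ((1 : ℝ) / 8) ^ m = (((1 : ℝ) / 2) ^ m) ^ 3 := by rw [← pow_mul, mul_comm, pow_mul]; norm_num
      _ = ∏ _i : Fin 3, ((1 : ℝ) / 2) ^ m := by rw [Finset.prod_const, Finset.card_univ, Fintype.card_fin]
      _ ≤ ∏ i : Fin 3, ((1 : ℝ) / 2) ^ (v i).natAbs :=
          Finset.prod_le_prod (fun i _ => by positivity) (fun i _ => h1 i)
  -- `(1/8)^{m − n₀} ≤ 8^{n₀} (1/8)^m`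
  have h2 : ((1 : ℝ) / 8) ^ (m - n₀) ≤ (8 : ℝ) ^ n₀ * ((1 : ℝ) / 8) ^ m := by
    rcases _root_.le_or_gt n₀ m with h | h
    · have : (8 : ℝ) ^ n₀ * ((1 : ℝ) / 8) ^ m = ((1 : ℝ) / 8) ^ (m - n₀) := by
        rw [show m = (m - n₀) + n₀ from (Nat.sub_add_cancel h).symm, pow_add, Nat.add_sub_cancel]
        rw [show (8 : ℝ) ^ n₀ * (((1 : ℝ) / 8) ^ (m - n₀) * ((1 : ℝ) / 8) ^ n₀) =
          ((1 : ℝ) / 8) ^ (m - n₀) * ((8 : ℝ) * (1 / 8)) ^ n₀ by rw [mul_pow]; ring]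
        norm_num
      rw [this]
    · rw [Nat.sub_eq_zero_of_le h.le, pow_zero]
      have h8 : ((1 : ℝ) / 8) ^ m = ((8 : ℝ) ^ m)⁻¹ := by rw [one_div, inv_pow]
      rw [h8, show (8 : ℝ) ^ n₀ = (8 : ℝ) ^ m * (8 : ℝ) ^ (n₀ - m) by rw [← pow_add]; congr 1; omega]
      rw [mul_assoc, mul_comm ((8 : ℝ) ^ (n₀ - m)), ← mul_assoc, mul_inv_cancel₀ (by positivity), one_mul]
      exact one_le_pow₀ (by norm_num)
  exact h2.trans (mul_le_mul_of_nonneg_left hprod (by positivity))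

end Summit.QuantumFields.YangMills.Cruxes.IR.SCFloor
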